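import Literature.NumberTheory.Automorphic.UnitaryGroupAutomorphicRep
import Literature.LinearAlgebra.Matrix.IsometryConjugacyClassesAlgClosed
import HarnessLib

/-!
# Kottwitz's Lemma 7.1 in the tower formalism: conjugacy in `GU(J)(K)` (`K = K̄`, Cases C and D) is
# «same multiplier and conjugate in `GL_n(K)`»; conjugacy in `U(id, J)(K) = Sp(J)(K)` / `O(J)(K)` is `GL`-conjugacy

Topic `NumberTheory/Automorphic`, namespace `Literature.NumberTheory.Automorphic.UnitarySimilitude` (lane
`lit-hodgefound`, Track 2 foundations; seat `lit-hodgefound-p11`, generation 32, row g32-#4).  THEOREMS ONLY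
(D-0026): no definition, no named fact, no instance, no notation.  BRIDGE between ✔
`LinearAlgebra/Matrix/IsometryConjugacyAlgClosed` (g32-#1: the square-root argument, on plain matrices) and the
carriers of this directory: the unitary group `unitaryGroupOfForm σ J ≤ GL n R` of
`Automorphic/UnitaryGroupAutomorphicRep` and the similitude group on points
`GU(J)(A) = {(g, t) ∈ GL_n(R) × Aˣ : ᵗσ(g) J g = ι(t) J}` of ✔ `Automorphic/UnitarySimilitudeNormTorus` (g30-#4,
introduced through its membership condition `hG`), both taken at `A = R = K`, `σ = ι = id` — the `K`-points of one
factor of Kottwitz's `G` in Cases C (`J` alternating) and D (`J` symmetric).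

## The print, verbatim

R. E. Kottwitz, *Points on some Shimura varieties over finite fields*, J. Amer. Math. Soc. **5** (1992) [Kottwitz1992],
§7 p. 395 (held text `paper:doi-10-2307-2152772` p0023 L1–L19): «For this we consider the obvious embedding
`i : G ↪ H`, where `H` denotes the `ℚ`-group `C^×` […], as well as the homomorphism `c : G → 𝔾_m` that associates
to `g ∈ G(K)` the scalar `c(g) ∈ K^×` such that `(gv, gw) = c(v, w)` for all `v, w ∈ V`.  **Lemma 7.1.** Two
elements `x, y` of `G(K)` are conjugate if and only if `c(x) = c(y)` and `i(x), i(y)` are conjugate in `H(K)`. […]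
we may reduce to the case in which `G₁ ↪ H` is of one of the three following types: (A) `GL_n ↪ GL_n × GL_n`
(diagonal map), (C) `Sp_{2n} ↪ GL_{2n}`, (D) `O_{2n} ↪ GL_{2n}`.»

## What is formalised (`K` algebraically closed with `2 ≠ 0` ⊇ Kottwitz's `K ⊇ ℚ`; `det J` a unit, `Jᵀ = ε J`,
## `ε² = 1`; one factor)

* **`isConj_unitaryGroupOfForm_id_iff`**: for `x, y ∈ U(id, J)(K)` (`= Sp(J)(K)` resp. `O(J)(K)`, `c = 1`),
  `IsConj x y` in `U(id, J)(K)` iff `IsConj (x : GL n K) y`; **`isConj_inv_unitaryGroupOfForm_id`** (every element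
  of `U(id, J)(K)` is conjugate IN `U(id, J)(K)` to its inverse — reality, via ✔ `IsometryConjugacyClassesAlgClosed`);
  the same two statements for Mathlib's group `Matrix.symplecticGroup l K`: **`isConj_symplecticGroup_iff`**,
  **`isConj_inv_symplecticGroup`**.
* **`isConj_similitude_iff`** (Lemma 7.1, Cases C/D, one factor): for `x, y ∈ GU(J)(K) ≤ GL_n(K) × Kˣ`
  (membership `ᵗg J g = t J`), `IsConj x y` in `GU(J)(K)` iff `c(x) = c(y)` (`x.2 = y.2`) and `IsConj x.1 y.1` in
  `GL_n(K)`; `snd_eq_of_isConj` / `isConj_fst_of_isConj` are the two «only if» halves (any commutative ring of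
  scalars would do for them; stated here for `K`).

## References

* [Kottwitz1992] §7 Lemma 7.1, p. 395.
* [FeitZuckerman1982] W. Feit, G. J. Zuckerman, *Reality properties of conjugacy classes in spin groups and
  symplectic groups*, Contemp. Math. 13 (1982), §1 p. 241 («every element of `Sp_{2m}(F)` is real», `F = F̄`).
* [SpringerSteinberg1970] Part E Ch. IV (through Kottwitz; not held, acq-13674).
-/

open scoped MatrixGroups
open Matrix

namespace Literature.NumberTheory.Automorphic.UnitarySimilitude

open Literature.LinearAlgebra.Matrix.IsometryConjugacy

variable {K : Type*} [Field K] {n : Type*} [Fintype n] [DecidableEq n]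

/-- Membership in `U(id, J)(K)` is `ᵗg J g = J`. [cite: Kottwitz1992, §5 p. 389] -/
theorem mem_unitaryGroupOfForm_ringHom_id_iff {J : Matrix n n K} {g : GL n K} :
    g ∈ unitaryGroupOfForm (RingHom.id K) J ↔ (g : Matrix n n K)ᵀ * J * (g : Matrix n n K) = J := by
  rw [mem_unitaryGroupOfForm_iff, RingHom.coe_id, Matrix.map_id]

/-- **Lemma 7.1 with `c = 1` (one factor of type C or D): conjugacy in `G₁(K) = U(id, J)(K)` is conjugacy in
`GL_n(K)`** for `K` algebraically closed with `2 ≠ 0`, `det J` a unit, `Jᵀ = ε J`, `ε² = 1`.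
[cite: Kottwitz1992, §7 Lemma 7.1 p. 395] -/
theorem isConj_unitaryGroupOfForm_id_iff [IsAlgClosed K] (h2 : (2 : K) ≠ 0) {J : Matrix n n K}
    (hJ : IsUnit J.det) {ε : K} (hε : ε * ε = 1) (hJt : Jᵀ = ε • J)
    (x y : unitaryGroupOfForm (RingHom.id K) J) :
    IsConj x y ↔ IsConj (x : GL n K) (y : GL n K) := by
  rw [isConj_iff, isConj_iff]
  have hx := mem_unitaryGroupOfForm_ringHom_id_iff.mp x.2
  have hy := mem_unitaryGroupOfForm_ringHom_id_iff.mp y.2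
  rw [← exists_gl_isometry_conj_iff h2 hJ hε hJt hx hy]
  constructor
  · rintro ⟨k, hk⟩
    exact ⟨k, mem_unitaryGroupOfForm_ringHom_id_iff.mp k.2, by rw [← hk]; rfl⟩
  · rintro ⟨k, hkJ, hk⟩
    refine ⟨⟨k, mem_unitaryGroupOfForm_ringHom_id_iff.mpr hkJ⟩, Subtype.ext ?_⟩
    exact hk

/-- **Reality in `U(id, J)(K)`**: every element of `Sp(J)(K)` / `O(J)(K)` (`K` algebraically closed, `2 ≠ 0`) is
conjugate in that group to its inverse. [cite: FeitZuckerman1982, §1 p. 241] [cite: Kottwitz1992, §7 Lemma 7.1 p. 395] -/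
theorem isConj_inv_unitaryGroupOfForm_id [IsAlgClosed K] (h2 : (2 : K) ≠ 0) {J : Matrix n n K}
    (hJ : IsUnit J.det) {ε : K} (hε : ε * ε = 1) (hJt : Jᵀ = ε • J)
    (x : unitaryGroupOfForm (RingHom.id K) J) : IsConj x x⁻¹ := by
  have hx := mem_unitaryGroupOfForm_ringHom_id_iff.mp x.2
  obtain ⟨k, hk, hkJ, hkx⟩ := exists_isometry_conj_inv h2 hJ hε hJt hx
  have hku : IsUnit k := (Matrix.isUnit_iff_isUnit_det k).mpr hk
  have hmem : hku.unit ∈ unitaryGroupOfForm (RingHom.id K) J := by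
    rw [mem_unitaryGroupOfForm_ringHom_id_iff, hku.unit_spec]; exact hkJ
  refine isConj_iff.mpr ⟨⟨hku.unit, hmem⟩, Subtype.ext ?_⟩
  change hku.unit * (x : GL n K) * hku.unit⁻¹ = ((x⁻¹ : unitaryGroupOfForm (RingHom.id K) J) : GL n K)
  rw [mul_inv_eq_iff_eq_mul, Subgroup.coe_inv]
  ext1
  rw [Units.val_mul, Units.val_mul, hku.unit_spec, Matrix.coe_units_inv, hkx]

/-- **Lemma 7.1 (Case C, `c = 1`) for Mathlib's `Sp_{2l}(K)`**: `IsConj x y` in the group `Matrix.symplecticGroup l K`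
iff the matrices are conjugate by an invertible matrix (`K` algebraically closed, `2 ≠ 0`).
[cite: Kottwitz1992, §7 Lemma 7.1 p. 395] -/
theorem isConj_symplecticGroup_iff [IsAlgClosed K] (h2 : (2 : K) ≠ 0) {l : Type*} [Fintype l] [DecidableEq l]
    (x y : Matrix.symplecticGroup l K) :
    IsConj x y ↔ ∃ g : Matrix (l ⊕ l) (l ⊕ l) K, IsUnit g.det ∧
      g * (x : Matrix (l ⊕ l) (l ⊕ l) K) = (y : Matrix (l ⊕ l) (l ⊕ l) K) * g := by
  rw [isConj_iff, ← symplecticGroup_exists_conj_iff h2 x.2 y.2]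
  constructor
  · rintro ⟨k, hk⟩
    refine ⟨k, k.2, ?_⟩
    have h := congrArg (fun z : Matrix.symplecticGroup l K => (z : Matrix (l ⊕ l) (l ⊕ l) K)) (mul_inv_eq_iff_eq_mul.mp hk)
    simpa only [Submonoid.coe_mul] using h
  · rintro ⟨k, hk, hkx⟩
    refine ⟨⟨k, hk⟩, mul_inv_eq_iff_eq_mul.mpr (Subtype.ext ?_)⟩
    simpa only [Submonoid.coe_mul] using hkx

/-- **Every element of Mathlib's `Sp_{2l}(K)` is real** (`K` algebraically closed, `2 ≠ 0`): `IsConj x x⁻¹` in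
`Matrix.symplecticGroup l K`. [cite: FeitZuckerman1982, §1 p. 241] [cite: Kottwitz1992, §7 Lemma 7.1 p. 395] -/
theorem isConj_inv_symplecticGroup [IsAlgClosed K] (h2 : (2 : K) ≠ 0) {l : Type*} [Fintype l] [DecidableEq l]
    (x : Matrix.symplecticGroup l K) : IsConj x x⁻¹ := by
  rw [isConj_symplecticGroup_iff h2]
  obtain ⟨k, hk, hkx⟩ := symplecticGroup_exists_conj_inv h2 x.2
  exact ⟨k, isUnit_det_of_isometry (Matrix.isUnit_det_J l K) (SymplecticGroup.mem_iff'.mp hk),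
    by rw [SymplecticGroup.coe_inv']; exact hkx⟩

section Similitude

variable {J : Matrix n n K} {G : Subgroup (GL n K × Kˣ)}

/-- **Lemma 7.1, «only if», the multiplier**: conjugate elements of `GU(J)(K)` have the same multiplier
(`c : G → 𝔾_m` is a homomorphism to a commutative group). [cite: Kottwitz1992, §7 Lemma 7.1 p. 395] -/
theorem snd_eq_of_isConj {x y : G} (h : IsConj x y) : (x : GL n K × Kˣ).2 = (y : GL n K × Kˣ).2 := by
  obtain ⟨k, hk⟩ := isConj_iff.mp h
  have h2 := congrArg (fun z : G => (z : GL n K × Kˣ).2) hk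
  simp only [Subgroup.coe_mul, Subgroup.coe_inv, Prod.snd_mul, Prod.snd_inv, mul_inv_cancel_comm] at h2
  exact h2

/-- **Lemma 7.1, «only if», the linear part**: conjugate elements of `GU(J)(K)` have `GL_n(K)`-conjugate
underlying matrices (`i : G ↪ H` is a homomorphism). [cite: Kottwitz1992, §7 Lemma 7.1 p. 395] -/
theorem isConj_fst_of_isConj {x y : G} (h : IsConj x y) :
    IsConj (x : GL n K × Kˣ).1 (y : GL n K × Kˣ).1 := by
  obtain ⟨k, hk⟩ := isConj_iff.mp h
  have h1 := congrArg (fun z : G => (z : GL n K × Kˣ).1) hk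
  simp only [Subgroup.coe_mul, Subgroup.coe_inv, Prod.fst_mul, Prod.fst_inv] at h1
  exact isConj_iff.mpr ⟨_, h1⟩

/-- **Kottwitz's Lemma 7.1 for one factor of type C or D, on `K`-points in the tower formalism**: let `K` be
algebraically closed with `2 ≠ 0` (`⊇ ℚ` as printed), `det J` a unit, `Jᵀ = ε J` with `ε² = 1`, and let
`GU(J)(K) ≤ GL_n(K) × Kˣ` be the similitude group `{(g, t) : ᵗg J g = t J}` (membership `hG`, as in
`UnitarySimilitudeNormTorus.exists_subgroup_forall_mem_iff` at `σ = ι = id`).  Then «two elements `x, y` of `G(K)`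
are conjugate if and only if `c(x) = c(y)` and `i(x), i(y)` are conjugate in `H(K)`» (`H(K) = GL_n(K)`).
[cite: Kottwitz1992, §7 Lemma 7.1 p. 395] -/
theorem isConj_similitude_iff [IsAlgClosed K] (h2 : (2 : K) ≠ 0) (hJ : IsUnit J.det) {ε : K}
    (hε : ε * ε = 1) (hJt : Jᵀ = ε • J)
    (hG : ∀ p, p ∈ G ↔ ((p.1 : Matrix n n K).map (RingHom.id K))ᵀ * J * (p.1 : Matrix n n K) =
      (RingHom.id K) (p.2 : K) • J)
    (x y : G) :
    IsConj x y ↔ (x : GL n K × Kˣ).2 = (y : GL n K × Kˣ).2 ∧ IsConj (x : GL n K × Kˣ).1 (y : GL n K × Kˣ).1 := by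
  refine ⟨fun h => ⟨snd_eq_of_isConj h, isConj_fst_of_isConj h⟩, ?_⟩
  rintro ⟨hc, hconj⟩
  have hG' : ∀ p, p ∈ G ↔ ((p.1 : Matrix n n K))ᵀ * J * (p.1 : Matrix n n K) = (p.2 : K) • J := by
    intro p; rw [hG, RingHom.id_apply, RingHom.coe_id, Matrix.map_id]
  have hx := (hG' _).mp x.2
  have hy := (hG' _).mp y.2
  rw [← hc] at hy
  obtain ⟨g, hg⟩ := isConj_iff.mp hconj
  have hxy : (g : Matrix n n K) * ((x : GL n K × Kˣ).1 : Matrix n n K) = ((y : GL n K × Kˣ).1 : Matrix n n K) * g := by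
    rw [← Units.val_mul, ← Units.val_mul, mul_inv_eq_iff_eq_mul.mp hg]
  obtain ⟨k, hk, hkJ, hkx⟩ := exists_isometry_conj_of_multiplier_eq h2 hJ hε hJt
    (Units.ne_zero _) hx hy (Matrix.isUnits_det_units g) hxy
  have hku : IsUnit k := (Matrix.isUnit_iff_isUnit_det k).mpr hk
  -- the conjugating element `(k, 1) ∈ GU(J)(K)`
  have hmem : (hku.unit, (1 : Kˣ)) ∈ G := by
    rw [hG', hku.unit_spec, Units.val_one, one_smul]; exact hkJ
  refine isConj_iff.mpr ⟨⟨(hku.unit, 1), hmem⟩, Subtype.ext ?_⟩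
  simp only [Subgroup.coe_mul, Subgroup.coe_inv]
  ext1
  · -- first component: `k x.1 k⁻¹ = y.1`
    simp only [Prod.fst_mul, Prod.fst_inv]
    rw [mul_inv_eq_iff_eq_mul]
    ext1
    rw [Units.val_mul, Units.val_mul, hku.unit_spec, hkx]
  · -- second component: `1 · c · 1⁻¹ = c`
    simp only [Prod.snd_mul, Prod.snd_inv, inv_one, mul_one, one_mul]
    exact hc

end Similitude

end Literature.NumberTheory.Automorphic.UnitarySimilitude
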